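import Mathlib
import HarnessLib
import Literature.RingTheory.CohomologyAnnihilator.Completion
import Literature.RingTheory.CohomologyAnnihilator.RegularLocalRing
import Literature.RingTheory.CohomologyAnnihilator.SyzygyBaseChange
import Summits.ResolutionOfSingularities.ResolutionOfSingularities.Theorems.HomologicalConductorNoZenoStableAnnihilatorReduction

set_option linter.dupNamespace false

/-!
# Over an isolated singularity of dimension `d`, `d`-th syzygies are punctured-free

`[OURS · L w44b · completion model, ascent half · res-type-015 gen 15]` — seventh brick towards the
discharge of the named fact `Literature.RingTheory.CohomologyAnnihilator.le_caCompletion_comap`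
([BahlekehHakimianSalarianTakahashi2015, Thm. 4.5 (2)]), helper for the surface rung
`PersistenceSurface` (stmt-ResolutionOfSingularities-19970) of crux chain w44b.  NOT a statement of
the manuscript under adjudication in cell res-hironaka; commutative algebra over Mathlib and the
tree's cohomology-annihilator library (`IsIsolatedSingularity` of `Completion.lean`, Serre's theorem
`cohomologyAnnihilatorOfDegree_eq_top_of_isRegularLocalRing`, the reduction lemma CA1
`mem_cohomologyAnnihilatorOfDegree_succ_iff_forall_isSyzygy`, flat base change of syzygies).

The sentence «since `R̂` is an isolated singularity, `Ω^d X` is in `mod₀ R̂`» of the printed proof of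
[BHST15, Thm. 4.5 (2)], in the operative form used by the sibling file `…CompletionAscentRetract`:

* `projective_baseChange_atPrime_of_isSyzygy` — over a noetherian local isolated singularity
  `(S, 𝔫)` of dimension `d`, for `W = Ωᵈ X` and a prime `𝔭 ≠ 𝔫`, the `S_𝔭`-module `S_𝔭 ⊗_S W` is
  projective (`S_𝔭` is regular of dimension `≤ d`, so `ca^{d+1}(S_𝔭) = S_𝔭` by Serre, and by CA1
  the identity of the `d`-th syzygy `S_𝔭 ⊗ W` of `S_𝔭 ⊗ X` factors through a projective);
* `exists_stablyAnnihilates_pow_of_projective_atPrime` — a finitely generated module `W` over a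
  noetherian local ring whose localisations `S_𝔭 ⊗ W` at all primes `𝔭 ≠ 𝔫` are projective is
  stably annihilated by a power of every `y ∈ 𝔫` (the ideal of scalars `u` with `u • 𝟙 W` lifting
  to a free cover is contained in no prime `≠ 𝔫`: lift a splitting of the localised cover with
  `Module.FinitePresentation.exists_lift_of_isLocalizedModule`);
* `puncturedFree_of_isSyzygy_of_isIsolatedSingularity` — the combination.

References: A. Bahlekeh, E. Hakimian, S. Salarian, R. Takahashi, arXiv:1504.06163, Thm. 4.5 (2)
[`BahlekehHakimianSalarianTakahashi2015`].
-/

noncomputable section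

open CategoryTheory IsLocalRing Literature.RingTheory.CohomologyAnnihilator
open Summit.ResolutionOfSingularities.ResolutionOfSingularities.Theorems.NoZeno.SandwichCluster
open scoped TensorProduct

universe u

namespace Summit.ResolutionOfSingularities.ResolutionOfSingularities.Theorems.HomologicalConductor.CompletionAscentIsolated

variable {S : Type u} [CommRing S]

/-! ## Isolated singularity: `d`-th syzygies are free on the punctured spectrum -/

/-- A module whose identity factors through a finitely generated projective (stable annihilation by
`1`) is projective. [folklore] -/
theorem moduleProjective_of_stablyAnnihilates_one {W : ModuleCat.{u} S} (h : StablyAnnihilates S 1 W) :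
    Module.Projective S W := by
  obtain ⟨P, _, hP, ι, π, hιπ⟩ := h
  haveI := moduleProjective_of_projective P hP
  refine Module.Projective.of_split ι.hom π.hom (LinearMap.ext fun w => ?_)
  rw [LinearMap.comp_apply, apply_apply_eq_smul_of_comp_eq_smul_id hιπ w, one_smul, LinearMap.id_apply]

/-- **`Ωᵈ X` is free on the punctured spectrum of a `d`-dimensional isolated singularity.**  Let
`(S, 𝔫)` be a noetherian local ring of Krull dimension `d` which is an isolated singularity, `X` a
finitely generated `S`-module and `W` a `d`-th syzygy of `X`.  Then for every prime `𝔭 ≠ 𝔫` the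
`S_𝔭`-module `S_𝔭 ⊗_S W` is projective: it is a `d`-th syzygy of `S_𝔭 ⊗_S X` over the regular local
ring `S_𝔭` of dimension `ht 𝔭 ≤ d`, whose `ca^{d+1}` is the unit ideal (Serre), so by the reduction
lemma CA1 its identity factors through a projective.
[cite: BahlekehHakimianSalarianTakahashi2015, Theorem 4.5 (2) (proof, «`Ω^d_R̂ X ∈ mod₀ R̂`»)] -/
theorem projective_baseChange_atPrime_of_isSyzygy [IsNoetherianRing S] [IsLocalRing S]
    (hiso : IsIsolatedSingularity S) {d : ℕ} (hd : ringKrullDim S = d) {X W : ModuleCat.{u} S}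
    [Module.Finite S X] (hW : IsSyzygy d X W) (𝔭 : Ideal S) [𝔭.IsPrime] (h𝔭 : 𝔭 ≠ maximalIdeal S) :
    Module.Projective (Localization.AtPrime 𝔭) (Localization.AtPrime 𝔭 ⊗[S] W) := by
  haveI : IsRegularLocalRing (Localization.AtPrime 𝔭) := hiso 𝔭 h𝔭
  -- `dim S_𝔭 = ht 𝔭 = r ≤ d`
  have hht : (𝔭.height : WithBot ℕ∞) ≤ d := by
    rw [← hd, ← IsLocalRing.maximalIdeal_height_eq_ringKrullDim]
    exact_mod_cast Ideal.height_mono (IsLocalRing.le_maximalIdeal Ideal.IsPrime.ne_top')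
  have hne : 𝔭.height ≠ ⊤ := Ideal.height_ne_top Ideal.IsPrime.ne_top'
  obtain ⟨r, hr⟩ := ENat.ne_top_iff_exists.mp hne
  have hdim : ringKrullDim (Localization.AtPrime 𝔭) = r := by
    rw [IsLocalization.AtPrime.ringKrullDim_eq_height 𝔭, ← hr]
    rfl
  have hrd : r ≤ d := by
    rw [← hr] at hht
    exact_mod_cast hht
  -- `ca^{d+1}(S_𝔭) = ⊤`
  have htop : cohomologyAnnihilatorOfDegree (Localization.AtPrime 𝔭) (d + 1) = ⊤ := by
    rw [eq_top_iff, ← cohomologyAnnihilatorOfDegree_eq_top_of_isRegularLocalRing _ hdim]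
    exact cohomologyAnnihilatorOfDegree_mono (by omega)
  -- `S_𝔭 ⊗ W` is a `d`-th syzygy of `S_𝔭 ⊗ X`; CA1 with `x = 1`
  have hW' : IsSyzygy d (ModuleCat.of (Localization.AtPrime 𝔭) (Localization.AtPrime 𝔭 ⊗[S] X))
      (ModuleCat.of (Localization.AtPrime 𝔭) (Localization.AtPrime 𝔭 ⊗[S] W)) :=
    IsSyzygy.baseChange (Localization.AtPrime 𝔭) d hW
  have h1 : (1 : Localization.AtPrime 𝔭) ∈
      cohomologyAnnihilatorOfDegree (Localization.AtPrime 𝔭) (d + 1) := by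
    rw [htop]; exact Submodule.mem_top
  have hst := (mem_cohomologyAnnihilatorOfDegree_succ_iff_forall_isSyzygy (1 : Localization.AtPrime 𝔭)).mp
    h1 _ _ (Module.Finite.base_change S (Localization.AtPrime 𝔭) X) hW'
  exact moduleProjective_of_stablyAnnihilates_one hst

/-! ## Free on the punctured spectrum ⇒ stably annihilated by a power of every element of `𝔫` -/

/-- If a linear map out of a finitely generated module dies pointwise after multiplication by
elements of a submonoid, a single element of the submonoid kills it. [folklore] -/
theorem exists_smul_eq_zero_of_forall {W V : Type u} [AddCommGroup W] [Module S W] [Module.Finite S W]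
    [AddCommGroup V] [Module S V] (M : Submonoid S) (φ : W →ₗ[S] V)
    (h : ∀ w : W, ∃ t ∈ M, t • φ w = 0) : ∃ t ∈ M, t • φ = 0 := by
  classical
  obtain ⟨G, hG⟩ := Module.Finite.fg_top (R := S) (M := W)
  choose t ht htφ using h
  refine ⟨∏ g ∈ G, t g, Submonoid.prod_mem M fun g _ => ht g, ?_⟩
  refine LinearMap.ext_on (s := (G : Set W)) hG fun g hg => ?_
  rw [LinearMap.zero_apply, LinearMap.smul_apply, ← Finset.prod_erase_mul G t hg, mul_smul, htφ,
    smul_zero]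

/-- **Free on the punctured spectrum ⇒ punctured-free.**  Let `(S, 𝔫)` be noetherian local and `W`
a finitely generated `S`-module such that `S_𝔭 ⊗_S W` is a projective `S_𝔭`-module for every prime
`𝔭 ≠ 𝔫`.  Then for every `y ∈ 𝔫` some power `yᵉ` stably annihilates `W`: with a finite free cover
`π : Sⁿ ↠ W`, the scalars `u` such that `u • 𝟙 W = π ψ` for some `ψ` form an ideal `J` contained in no
prime `𝔭 ≠ 𝔫` (localise a splitting of `π ⊗ S_𝔭` and lift it to `S` on the finitely presented `W`),
hence `𝔫 ⊆ √J`. [folklore] -/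
theorem exists_stablyAnnihilates_pow_of_projective_atPrime [IsNoetherianRing S] [IsLocalRing S]
    {W : ModuleCat.{u} S} [Module.Finite S W]
    (hW : ∀ (𝔭 : Ideal S) [𝔭.IsPrime], 𝔭 ≠ maximalIdeal S →
      Module.Projective (Localization.AtPrime 𝔭) (Localization.AtPrime 𝔭 ⊗[S] W)) :
    ∀ y ∈ maximalIdeal S, ∃ e : ℕ, StablyAnnihilates S (y ^ e) W := by
  classical
  haveI : Module.FinitePresentation S W := Module.finitePresentation_of_finite S W
  obtain ⟨n, π, hπ⟩ := Module.Finite.exists_fin' S W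
  -- the ideal of scalars whose homothety lifts to the cover
  let J : Ideal S :=
    { carrier := {u | ∃ ψ : W →ₗ[S] (Fin n → S), π ∘ₗ ψ = u • LinearMap.id}
      add_mem' := by
        rintro u v ⟨ψ, hψ⟩ ⟨χ, hχ⟩
        exact ⟨ψ + χ, by rw [LinearMap.comp_add, hψ, hχ, add_smul]⟩
      zero_mem' := ⟨0, by rw [LinearMap.comp_zero, zero_smul]⟩
      smul_mem' := by
        rintro c u ⟨ψ, hψ⟩
        exact ⟨c • ψ, by rw [LinearMap.comp_smul, hψ, smul_eq_mul, mul_smul]⟩ }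
  have hJ : ∀ u, u ∈ J ↔ ∃ ψ : W →ₗ[S] (Fin n → S), π ∘ₗ ψ = u • LinearMap.id := fun u => Iff.rfl
  -- `J ⊄ 𝔭` for every prime `𝔭 ≠ 𝔫`
  have hJp : ∀ (𝔭 : Ideal S) [𝔭.IsPrime], 𝔭 ≠ maximalIdeal S → ¬ J ≤ 𝔭 := by
    intro 𝔭 _ h𝔭 hle
    haveI := hW 𝔭 h𝔭
    let Sp := Localization.AtPrime 𝔭
    let fW : W →ₗ[S] Sp ⊗[S] W := TensorProduct.mk S Sp W 1
    let fP : (Fin n → S) →ₗ[S] Sp ⊗[S] (Fin n → S) := TensorProduct.mk S Sp (Fin n → S) 1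
    let πp : Sp ⊗[S] (Fin n → S) →ₗ[Sp] Sp ⊗[S] W := π.baseChange Sp
    have hπp : Function.Surjective πp := by
      change Function.Surjective (π.baseChange Sp)
      rw [LinearMap.baseChange_eq_ltensor]
      exact LinearMap.lTensor_surjective Sp hπ
    obtain ⟨σ, hσ⟩ := Module.projective_lifting_property πp LinearMap.id hπp
    have hσ' : ∀ v, πp (σ v) = v := fun v => LinearMap.congr_fun hσ v
    -- lift `σ ∘ fW` to `S`
    obtain ⟨h, s, hhs⟩ := Module.FinitePresentation.exists_lift_of_isLocalizedModule 𝔭.primeCompl fP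
      (σ.restrictScalars S ∘ₗ fW)
    -- `fW ∘ (π h - s • 𝟙) = 0`
    let δ : W →ₗ[S] W := π ∘ₗ h - (s : S) • LinearMap.id
    have hδ : ∀ w : W, δ w = π (h w) - (s : S) • w := fun w => rfl
    have hzero : ∀ w : W, fW (δ w) = 0 := by
      intro w
      have hnat : fW (π (h w)) = πp (fP (h w)) := by
        change (1 : Sp) ⊗ₜ[S] π (h w) = π.baseChange Sp ((1 : Sp) ⊗ₜ[S] h w)
        rw [LinearMap.baseChange_tmul]
      have hfP : fP (h w) = (s : S) • σ (fW w) := by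
        have := LinearMap.congr_fun hhs w
        rw [LinearMap.comp_apply, LinearMap.smul_apply, Submonoid.smul_def] at this
        exact this
      rw [hδ, map_sub, hnat, hfP, LinearMap.map_smul_of_tower, hσ', LinearMap.map_smul, sub_self]
    have hkill : ∀ w : W, ∃ t ∈ 𝔭.primeCompl, t • δ w = 0 := by
      intro w
      obtain ⟨c, hc⟩ := (IsLocalizedModule.exists_of_eq (S := 𝔭.primeCompl) (f := fW)
        (x₁ := δ w) (x₂ := 0) (by rw [hzero, map_zero]))
      exact ⟨c, c.2, by rw [← Submonoid.smul_def, hc, smul_zero]⟩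
    obtain ⟨t, ht, htφ⟩ := exists_smul_eq_zero_of_forall 𝔭.primeCompl δ hkill
    -- `(t s) • 𝟙 = π ∘ (t • h)`, so `t s ∈ J ∖ 𝔭`
    have hmem : t * s ∈ J := by
      refine (hJ _).mpr ⟨t • h, ?_⟩
      have htφ' : t • (π ∘ₗ h) = t • ((s : S) • (LinearMap.id : W →ₗ[S] W)) := by
        rw [← sub_eq_zero, ← smul_sub]
        exact htφ
      rw [LinearMap.comp_smul, htφ', smul_smul]
    exact (𝔭.primeCompl.mul_mem ht s.2) (hle hmem)
  -- hence `𝔫 ⊆ √J`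
  have hrad : maximalIdeal S ≤ J.radical := by
    rw [Ideal.radical_eq_sInf]
    refine le_sInf ?_
    rintro 𝔭 ⟨hJ𝔭, h𝔭prime⟩
    by_cases h𝔭 : 𝔭 = maximalIdeal S
    · exact h𝔭.ge
    · exact absurd hJ𝔭 (hJp 𝔭 h𝔭)
  intro y hy
  obtain ⟨e, he⟩ := (Ideal.mem_radical_iff.mp (hrad hy))
  obtain ⟨ψ, hψ⟩ := (hJ _).mp he
  refine ⟨e, ModuleCat.of S (Fin n → S), inferInstance,
    (IsProjective.iff_projective (R := S) (Fin n → S)).mp inferInstance,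
    ModuleCat.ofHom ψ, ModuleCat.ofHom π, ?_⟩
  apply ModuleCat.hom_ext
  change π ∘ₗ ψ = _
  rw [hψ]
  rfl

/-- **Over a `d`-dimensional isolated singularity, `d`-th syzygies are punctured-free**: for
`(S, 𝔫)` noetherian local of Krull dimension `d` and an isolated singularity, every `d`-th syzygy
`W = Ωᵈ X` of a finitely generated module is stably annihilated by a power of every `y ∈ 𝔫`.
[cite: BahlekehHakimianSalarianTakahashi2015, Theorem 4.5 (2) (proof)] -/
theorem puncturedFree_of_isSyzygy_of_isIsolatedSingularity [IsNoetherianRing S] [IsLocalRing S]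
    (hiso : IsIsolatedSingularity S) {d : ℕ} (hd : ringKrullDim S = d) {X W : ModuleCat.{u} S}
    [Module.Finite S X] (hW : IsSyzygy d X W) :
    ∀ y ∈ maximalIdeal S, ∃ e : ℕ, StablyAnnihilates S (y ^ e) W := by
  haveI : Module.Finite S W := finite_of_isSyzygy d ‹_› hW
  exact exists_stablyAnnihilates_pow_of_projective_atPrime
    (fun 𝔭 _ h𝔭 => projective_baseChange_atPrime_of_isSyzygy hiso hd hW 𝔭 h𝔭)

end Summit.ResolutionOfSingularities.ResolutionOfSingularities.Theorems.HomologicalConductor.CompletionAscentIsolated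

end
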